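import Summits.CriticalPhenomena.Ising3DConformalLimit.Theses.SubPtolemyInterlacing
import Literature.Probability.LatticeModels.GHSInequality
import Literature.Probability.LatticeModels.CriticalUrsellFourSign
import Literature.Probability.LatticeModels.CriticalAxisRatioRegularity
import HarnessLib

/-!
# Crux idea `ghs-pivot-merging-floor` — first lemmas (crux stmt-CriticalPhenomena-15702, `Interlacing`)

GHS with a PIVOT spin.  Conditioning the zero-field ferromagnet on `σ_p = +1` (`p` one of the four
points) produces nonnegative one-body couplings `β J_{pi}` on the neighbours of `p`; the GHS inequality
`u₃ ≤ 0` in that system, read back through `⟨σ_A⟩^{(σ_p=+)} = ⟨σ_p σ_A⟩` (`|A|` odd) and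
`⟨σ_A⟩^{(σ_p=+)} = ⟨σ_A⟩` (`|A|` even), is the four-spin inequality

  `⟨σ_pσ_aσ_bσ_c⟩ ≤ G_pa G_bc + G_pb G_ac + G_pc G_ab - 2 G_pa G_pb G_pc`,

i.e. `U₄(p,a,b,c) ≤ -2 G_pa G_pb G_pc` — a LOWER bound on `|U₄|` (equality on trees).  In the merging
currency of the crux (`-U₄ = 2 P₂ I×`) it is the floor `I× ≥ R_j` with
`R₂ = G₁₂G₂₃/G₁₃`, `R₃ = G₂₃G₃₄/G₂₄`, `R₁ = G₁₂G₁₄/G₂₄`, `R₄ = G₁₄G₃₄/G₁₃`, so that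
SPC(a,b,c) holds whenever `max_j R_j ≥ ι* = 1 - (u-1)(t-1)/2` — the "GHS regime", a pure two-point
criterion complementing the Lebowitz regime `(u-1)(t-1) ≥ 2` of the dead line `Sketch`.
-/

noncomputable section

/-! ## Part A — the GHS pivot inequality on any locally finite graph (free b.c., zero field): PROVED -/

namespace Literature.Probability.LatticeModels.GHSPivot

open Finset Filter
open scoped Topology

variable {V : Type*} [DecidableEq V] (G : SimpleGraph V) [G.LocallyFinite]

/-- The free zero-field couplings plus a field `κ` at the single site `p`. -/
def pivotCoupling (Λ : Finset V) (β κ : ℝ) (p : V) : Sym2 V ⊕ V → ℝ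
  | .inl e => gksCoupling G Λ β 0 .free (.inl e)
  | .inr x => if x = p then κ else 0

theorem pivotCoupling_nonneg {Λ : Finset V} {β κ : ℝ} (hβ : 0 ≤ β) (hκ : 0 ≤ κ) (p : V) :
    ∀ i ∈ isingIdx G Λ, 0 ≤ pivotCoupling G Λ β κ p i := by
  intro i hi
  cases i with
  | inl e => exact gksCoupling_nonneg G hβ le_rfl (Or.inl rfl) (.inl e) hi
  | inr x => simp only [pivotCoupling]; split_ifs <;> [exact hκ; exact le_rfl]

/-- The tilted Hamiltonian is the free zero-field one plus `κ σ_p`. -/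
theorem gksHamiltonian_pivot (Λ : Finset V) (β κ : ℝ) {p : V} (hp : p ∈ Λ) (τ : SpinConfig ↥Λ) :
    gksHamiltonian (isingIdx G Λ) (pivotCoupling G Λ β κ p) (isingSupp Λ) τ =
      gksHamiltonian (isingIdx G Λ) (gksCoupling G Λ β 0 .free) (isingSupp Λ) τ +
        κ * spinAt p (glue Λ τ .free) := by
  simp only [gksHamiltonian, isingIdx, Finset.sum_disjSum]
  have hE : ∑ e ∈ edgesTouching G Λ, pivotCoupling G Λ β κ p (.inl e) * spinProduct (isingSupp Λ (.inl e)) τ =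
      ∑ e ∈ edgesTouching G Λ, gksCoupling G Λ β 0 .free (.inl e) * spinProduct (isingSupp Λ (.inl e)) τ :=
    Finset.sum_congr rfl fun e _ => rfl
  have hS0 : ∑ x ∈ Λ, gksCoupling G Λ β 0 .free (.inr x) * spinProduct (isingSupp Λ (.inr x)) τ = 0 := by
    refine Finset.sum_eq_zero fun x _ => ?_
    simp [gksCoupling]
  have hS : ∑ x ∈ Λ, pivotCoupling G Λ β κ p (.inr x) * spinProduct (isingSupp Λ (.inr x)) τ =
      κ * spinAt p (glue Λ τ .free) := by
    rw [Finset.sum_eq_single p]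
    · simp only [pivotCoupling, if_true]
      rw [spinProduct_isingSupp_inr τ .free hp]
    · intro x _ hxp
      simp [pivotCoupling, hxp]
    · intro hnp; exact absurd hp hnp
  rw [hE, hS, hS0, add_zero]

/-- The tilted weight: `w_κ(τ) = w₀(τ) · (cosh κ + σ_p sinh κ)`. -/
theorem gksWeight_pivot (Λ : Finset V) (β κ : ℝ) {p : V} (hp : p ∈ Λ) (τ : SpinConfig ↥Λ) :
    gksWeight (isingIdx G Λ) (pivotCoupling G Λ β κ p) (isingSupp Λ) τ =
      gksWeight (isingIdx G Λ) (gksCoupling G Λ β 0 .free) (isingSupp Λ) τ *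
        (Real.cosh κ + spinAt p (glue Λ τ .free) * Real.sinh κ) := by
  rw [gksWeight, gksWeight, gksHamiltonian_pivot G Λ β κ hp, Real.exp_add,
    exp_mul_eq_cosh_add_mul_sinh κ (spinAt_eq_one_or_eq_neg_one p _)]

/-- Unnormalised expectations of the tilted system: `Σ_κ(g) = cosh κ · Σ₀(g) + sinh κ · Σ₀(g σ_p)`. -/
theorem gksSum_pivot (Λ : Finset V) (β κ : ℝ) {p : V} (hp : p ∈ Λ) (g : SpinConfig ↥Λ → ℝ) :
    gksSum (isingIdx G Λ) (pivotCoupling G Λ β κ p) (isingSupp Λ) g =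
      Real.cosh κ * gksSum (isingIdx G Λ) (gksCoupling G Λ β 0 .free) (isingSupp Λ) g +
        Real.sinh κ * gksSum (isingIdx G Λ) (gksCoupling G Λ β 0 .free) (isingSupp Λ)
          (fun τ => g τ * spinAt p (glue Λ τ .free)) := by
  simp only [gksSum, Finset.mul_sum, ← Finset.sum_add_distrib]
  refine Finset.sum_congr rfl fun τ _ => ?_
  rw [gksWeight_pivot G Λ β κ hp]
  ring


/-- Zero-field free sums of flip-odd functions vanish (spin-flip symmetry). -/
theorem gksSum_free_eq_zero_of_odd (Λ : Finset V) (β : ℝ) (g : SpinConfig ↥Λ → ℝ)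
    (hg : ∀ τ, g (-τ) = -g τ) :
    gksSum (isingIdx G Λ) (gksCoupling G Λ β 0 .free) (isingSupp Λ) g = 0 := by
  have hw : ∀ τ : SpinConfig ↥Λ, gksWeight (isingIdx G Λ) (gksCoupling G Λ β 0 .free) (isingSupp Λ) (-τ) =
      gksWeight (isingIdx G Λ) (gksCoupling G Λ β 0 .free) (isingSupp Λ) τ := by
    intro τ
    rw [← isingWeight_eq_gksWeight, ← isingWeight_eq_gksWeight]
    have h := isingWeight_neg_flip G Λ β 0 .free τ
    simpa using h
  have hsum : gksSum (isingIdx G Λ) (gksCoupling G Λ β 0 .free) (isingSupp Λ) g =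
      -gksSum (isingIdx G Λ) (gksCoupling G Λ β 0 .free) (isingSupp Λ) g := by
    conv_lhs => rw [gksSum, ← Fintype.sum_equiv (Equiv.neg _) _ _ (fun τ => rfl)]
    simp only [Equiv.neg_apply, gksSum, ← Finset.sum_neg_distrib]
    refine Finset.sum_congr rfl fun τ _ => ?_
    rw [hg, hw]
    ring
  linarith

/-- A spin inside `Λ` flips sign under `τ ↦ -τ` (free boundary condition). -/
theorem spinAt_glue_free_neg {Λ : Finset V} (τ : SpinConfig ↥Λ) {x : V} (hx : x ∈ Λ) :
    spinAt x (glue Λ (-τ) .free) = -spinAt x (glue Λ τ .free) := by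
  have h := spinAt_glue_neg_flip_of_mem Λ τ .free hx
  simpa using h

/-- **GHS with a pivot spin (free b.c., zero field), unnormalised**: with `Σ(g) = Z⟨g⟩` the free zero-field
sums and `σp τ := spinAt p (glue Λ τ .free)`,
`Z² Σ(σ_aσ_bσ_c σp) - Z (Σ(σ_aσ_b)Σ(σ_c σp) + Σ(σ_aσ_c)Σ(σ_b σp) + Σ(σ_bσ_c)Σ(σ_a σp)) + 2 Σ(σ_a σp)Σ(σ_b σp)Σ(σ_c σp) ≤ 0`. -/
theorem ghsPivot_gksSum {Λ : Finset V} {β : ℝ} (hβ : 0 ≤ β) {p : V} (hp : p ∈ Λ) (a b c : ↥Λ) :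
    gksSum (isingIdx G Λ) (gksCoupling G Λ β 0 .free) (isingSupp Λ) (fun _ => 1) ^ 2 *
          gksSum (isingIdx G Λ) (gksCoupling G Λ β 0 .free) (isingSupp Λ)
            (fun τ => spinAt a τ * spinAt b τ * spinAt c τ * spinAt p (glue Λ τ .free)) -
        gksSum (isingIdx G Λ) (gksCoupling G Λ β 0 .free) (isingSupp Λ) (fun _ => 1) *
          (gksSum (isingIdx G Λ) (gksCoupling G Λ β 0 .free) (isingSupp Λ) (fun τ => spinAt a τ * spinAt b τ) *
              gksSum (isingIdx G Λ) (gksCoupling G Λ β 0 .free) (isingSupp Λ)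
                (fun τ => spinAt c τ * spinAt p (glue Λ τ .free)) +
            gksSum (isingIdx G Λ) (gksCoupling G Λ β 0 .free) (isingSupp Λ) (fun τ => spinAt a τ * spinAt c τ) *
              gksSum (isingIdx G Λ) (gksCoupling G Λ β 0 .free) (isingSupp Λ)
                (fun τ => spinAt b τ * spinAt p (glue Λ τ .free)) +
            gksSum (isingIdx G Λ) (gksCoupling G Λ β 0 .free) (isingSupp Λ) (fun τ => spinAt b τ * spinAt c τ) *
              gksSum (isingIdx G Λ) (gksCoupling G Λ β 0 .free) (isingSupp Λ)
                (fun τ => spinAt a τ * spinAt p (glue Λ τ .free))) +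
        2 * (gksSum (isingIdx G Λ) (gksCoupling G Λ β 0 .free) (isingSupp Λ)
              (fun τ => spinAt a τ * spinAt p (glue Λ τ .free)) *
            gksSum (isingIdx G Λ) (gksCoupling G Λ β 0 .free) (isingSupp Λ)
              (fun τ => spinAt b τ * spinAt p (glue Λ τ .free)) *
            gksSum (isingIdx G Λ) (gksCoupling G Λ β 0 .free) (isingSupp Λ)
              (fun τ => spinAt c τ * spinAt p (glue Λ τ .free))) ≤ 0 := by
  -- spins flip sign under `τ ↦ -τ`
  have hflipΛ : ∀ (x : ↥Λ) (τ : SpinConfig ↥Λ), spinAt x (-τ) = -spinAt x τ := by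
    intro x τ; simp [spinAt, Units.val_neg]
  have hflipp : ∀ τ : SpinConfig ↥Λ, spinAt p (glue Λ (-τ) .free) = -spinAt p (glue Λ τ .free) :=
    fun τ => spinAt_glue_free_neg (Λ := Λ) τ hp
  -- odd zero-field sums vanish
  have h1 : gksSum (isingIdx G Λ) (gksCoupling G Λ β 0 .free) (isingSupp Λ)
      (fun τ => (1:ℝ) * spinAt p (glue Λ τ .free)) = 0 :=
    gksSum_free_eq_zero_of_odd G Λ β _ fun τ => by rw [hflipp]; ring
  have h3 : gksSum (isingIdx G Λ) (gksCoupling G Λ β 0 .free) (isingSupp Λ)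
      (fun τ => spinAt a τ * spinAt b τ * spinAt c τ) = 0 :=
    gksSum_free_eq_zero_of_odd G Λ β _ fun τ => by rw [hflipΛ, hflipΛ, hflipΛ]; ring
  have h3p : ∀ x y : ↥Λ, gksSum (isingIdx G Λ) (gksCoupling G Λ β 0 .free) (isingSupp Λ)
      (fun τ => spinAt x τ * spinAt y τ * spinAt p (glue Λ τ .free)) = 0 := fun x y =>
    gksSum_free_eq_zero_of_odd G Λ β _ fun τ => by rw [hflipΛ, hflipΛ, hflipp]; ring
  have h1x : ∀ x : ↥Λ, gksSum (isingIdx G Λ) (gksCoupling G Λ β 0 .free) (isingSupp Λ)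
      (fun τ => spinAt x τ) = 0 := fun x =>
    gksSum_free_eq_zero_of_odd G Λ β _ fun τ => by rw [hflipΛ]
  -- abbreviations
  set Z := gksSum (isingIdx G Λ) (gksCoupling G Λ β 0 .free) (isingSupp Λ) (fun _ => 1) with hZ
  set Q := gksSum (isingIdx G Λ) (gksCoupling G Λ β 0 .free) (isingSupp Λ)
    (fun τ => spinAt a τ * spinAt b τ * spinAt c τ * spinAt p (glue Λ τ .free)) with hQ
  set Sab := gksSum (isingIdx G Λ) (gksCoupling G Λ β 0 .free) (isingSupp Λ) (fun τ => spinAt a τ * spinAt b τ)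
  set Sac := gksSum (isingIdx G Λ) (gksCoupling G Λ β 0 .free) (isingSupp Λ) (fun τ => spinAt a τ * spinAt c τ)
  set Sbc := gksSum (isingIdx G Λ) (gksCoupling G Λ β 0 .free) (isingSupp Λ) (fun τ => spinAt b τ * spinAt c τ)
  set Sap := gksSum (isingIdx G Λ) (gksCoupling G Λ β 0 .free) (isingSupp Λ)
    (fun τ => spinAt a τ * spinAt p (glue Λ τ .free))
  set Sbp := gksSum (isingIdx G Λ) (gksCoupling G Λ β 0 .free) (isingSupp Λ)
    (fun τ => spinAt b τ * spinAt p (glue Λ τ .free))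
  set Scp := gksSum (isingIdx G Λ) (gksCoupling G Λ β 0 .free) (isingSupp Λ)
    (fun τ => spinAt c τ * spinAt p (glue Λ τ .free))
  set A := Z ^ 2 * Q - Z * (Sab * Scp + Sac * Sbp + Sbc * Sap) with hA
  set Pp := Sap * Sbp * Scp with hPp
  -- `A + 2 t² Pp ≤ 0` for every `t ∈ (0,1)`, from GHS in the tilted system with `tanh κ = t`
  have key : ∀ t ∈ Set.Ioo (0:ℝ) 1, A + 2 * t ^ 2 * Pp ≤ 0 := by
    intro t ht
    set κ := Real.artanh t with hκ
    have hth : Real.tanh κ = t := Real.tanh_artanh ⟨by linarith [ht.1], ht.2⟩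
    have hch : 0 < Real.cosh κ := Real.cosh_pos κ
    have hsh : 0 < Real.sinh κ := by
      have h0 := Real.tanh_eq_sinh_div_cosh κ
      rw [hth] at h0
      have h1 : Real.sinh κ = t * Real.cosh κ := by
        field_simp at h0
        linarith
      rw [h1]; exact mul_pos ht.1 hch
    have hκ0 : 0 ≤ κ := by
      by_contra hneg
      push_neg at hneg
      have : Real.sinh κ < 0 := Real.sinh_neg_iff.mpr hneg
      linarith
    -- GHS for the tilted couplings, rewritten through `gksSum_pivot` and the vanishing odd sums
    have hG := ghs_gksSum (isingIdx G Λ) (pivotCoupling G Λ β κ p) (isingSupp Λ)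
      (pivotCoupling_nonneg G hβ hκ0 p) (fun i _ => card_isingSupp_le_two Λ i) a b c
    simp only [gksSum_pivot G Λ β κ hp] at hG
    rw [h3, h1, h1x a, h1x b, h1x c, h3p a b, h3p a c, h3p b c] at hG
    simp only [mul_zero, zero_add, add_zero, zero_mul] at hG
    have hfac : (Real.cosh κ * Z) ^ 2 * (Real.sinh κ * Q) -
        Real.cosh κ * Z * (Real.cosh κ * Sab * (Real.sinh κ * Scp) + Real.cosh κ * Sac * (Real.sinh κ * Sbp) +
          Real.cosh κ * Sbc * (Real.sinh κ * Sap)) +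
        2 * (Real.sinh κ * Sap * (Real.sinh κ * Sbp) * (Real.sinh κ * Scp)) =
        Real.cosh κ ^ 2 * Real.sinh κ * (A + 2 * (Real.sinh κ / Real.cosh κ) ^ 2 * Pp) := by
      rw [hA, hPp]; field_simp
    have hG' : Real.cosh κ ^ 2 * Real.sinh κ * (A + 2 * (Real.sinh κ / Real.cosh κ) ^ 2 * Pp) ≤ 0 := by
      rw [← hfac]; linarith [hG]
    have hpos : 0 < Real.cosh κ ^ 2 * Real.sinh κ := by positivity
    have hle : A + 2 * (Real.sinh κ / Real.cosh κ) ^ 2 * Pp ≤ 0 := by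
      by_contra hcon
      push_neg at hcon
      exact absurd (mul_pos hpos hcon) (not_lt.mpr hG')
    rwa [← Real.tanh_eq_sinh_div_cosh, hth] at hle
  -- let `t → 1⁻`
  have hcont : Continuous fun t : ℝ => A + 2 * t ^ 2 * Pp := by continuity
  have ht : Tendsto (fun t : ℝ => A + 2 * t ^ 2 * Pp) (𝓝[<] 1) (𝓝 (A + 2 * 1 ^ 2 * Pp)) :=
    (hcont.tendsto 1).mono_left nhdsWithin_le_nhds
  have hev : ∀ᶠ t in 𝓝[<] (1:ℝ), A + 2 * t ^ 2 * Pp ≤ 0 := by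
    filter_upwards [Ioo_mem_nhdsLT (zero_lt_one' ℝ)] with t ht' using key t ht'
  have hlim := le_of_tendsto ht hev
  simp only [one_pow, mul_one] at hlim
  rw [hA, hPp] at hlim
  linarith

/-- **GHS with a pivot spin, free box, zero field** (L1 of the card `ghs-pivot-merging-floor`): for `β ≥ 0`
and `p a b c ∈ Λ`,
`⟨σ_pσ_aσ_bσ_c⟩ ≤ ⟨σ_pσ_a⟩⟨σ_bσ_c⟩ + ⟨σ_pσ_b⟩⟨σ_aσ_c⟩ + ⟨σ_pσ_c⟩⟨σ_aσ_b⟩ - 2⟨σ_pσ_a⟩⟨σ_pσ_b⟩⟨σ_pσ_c⟩`,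
i.e. `U₄(p,a,b,c) ≤ -2 G_pa G_pb G_pc` — GHS in the system pinned at `p` (field at `p` sent to `+∞`). -/
theorem ghsPivot_free {Λ : Finset V} {β : ℝ} (hβ : 0 ≤ β) {p a b c : V} (hp : p ∈ Λ) (ha : a ∈ Λ)
    (hb : b ∈ Λ) (hc : c ∈ Λ) :
    isingExpect G Λ β 0 .free (spinMonomial ![p, a, b, c]) ≤
      isingTwoPoint G Λ β 0 .free p a * isingTwoPoint G Λ β 0 .free b c +
        isingTwoPoint G Λ β 0 .free p b * isingTwoPoint G Λ β 0 .free a c +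
        isingTwoPoint G Λ β 0 .free p c * isingTwoPoint G Λ β 0 .free a b -
      2 * (isingTwoPoint G Λ β 0 .free p a * isingTwoPoint G Λ β 0 .free p b *
        isingTwoPoint G Λ β 0 .free p c) := by
  have h := ghsPivot_gksSum G hβ hp ⟨a, ha⟩ ⟨b, hb⟩ ⟨c, hc⟩
  simp only [spinAt_glue_of_mem _ _ hp] at h
  -- rewrite the seven expectations as ratios of zero-field sums
  have m4 : Measurable (spinMonomial (V := V) ![p, a, b, c]) := measurable_spinMonomial _
  have mpr : ∀ x y : V, Measurable (spinPair (V := V) x y) := fun x y =>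
    (measurable_spinAt x).mul (measurable_spinAt y)
  simp only [isingTwoPoint]
  rw [isingExpect_eq_gksSum_div G Λ β 0 .free m4, isingExpect_eq_gksSum_div G Λ β 0 .free (mpr p a),
    isingExpect_eq_gksSum_div G Λ β 0 .free (mpr b c), isingExpect_eq_gksSum_div G Λ β 0 .free (mpr p b),
    isingExpect_eq_gksSum_div G Λ β 0 .free (mpr a c), isingExpect_eq_gksSum_div G Λ β 0 .free (mpr p c),
    isingExpect_eq_gksSum_div G Λ β 0 .free (mpr a b)]
  simp only [spinMonomial, spinPair, Fin.prod_univ_four, Fin.isValue, Matrix.cons_val_zero, Matrix.cons_val_one,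
    Matrix.cons_val, spinAt_glue_of_mem _ _ hp, spinAt_glue_of_mem _ _ ha, spinAt_glue_of_mem _ _ hb,
    spinAt_glue_of_mem _ _ hc]
  -- normalise the order of the factors inside the integrands to match `h`
  have e4 : (fun τ : SpinConfig ↥Λ => spinAt (⟨p, hp⟩ : ↥Λ) τ * spinAt (⟨a, ha⟩ : ↥Λ) τ *
      spinAt (⟨b, hb⟩ : ↥Λ) τ * spinAt (⟨c, hc⟩ : ↥Λ) τ) =
      fun τ => spinAt (⟨a, ha⟩ : ↥Λ) τ * spinAt (⟨b, hb⟩ : ↥Λ) τ * spinAt (⟨c, hc⟩ : ↥Λ) τ *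
        spinAt (⟨p, hp⟩ : ↥Λ) τ := by funext τ; ring
  have e2 : ∀ x : ↥Λ, (fun τ : SpinConfig ↥Λ => spinAt (⟨p, hp⟩ : ↥Λ) τ * spinAt x τ) =
      fun τ => spinAt x τ * spinAt (⟨p, hp⟩ : ↥Λ) τ := fun x => by funext τ; ring
  rw [e4, e2 ⟨a, ha⟩, e2 ⟨b, hb⟩, e2 ⟨c, hc⟩]
  set Z := gksSum (isingIdx G Λ) (gksCoupling G Λ β 0 .free) (isingSupp Λ) (fun _ => 1) with hZdef
  have hZ : 0 < Z := gksSum_one_pos _ _ _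
  set Q := gksSum (isingIdx G Λ) (gksCoupling G Λ β 0 .free) (isingSupp Λ)
    (fun τ => spinAt (⟨a, ha⟩ : ↥Λ) τ * spinAt (⟨b, hb⟩ : ↥Λ) τ * spinAt (⟨c, hc⟩ : ↥Λ) τ * spinAt (⟨p, hp⟩ : ↥Λ) τ)
  set Sab := gksSum (isingIdx G Λ) (gksCoupling G Λ β 0 .free) (isingSupp Λ)
    (fun τ => spinAt (⟨a, ha⟩ : ↥Λ) τ * spinAt (⟨b, hb⟩ : ↥Λ) τ)
  set Sac := gksSum (isingIdx G Λ) (gksCoupling G Λ β 0 .free) (isingSupp Λ)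
    (fun τ => spinAt (⟨a, ha⟩ : ↥Λ) τ * spinAt (⟨c, hc⟩ : ↥Λ) τ)
  set Sbc := gksSum (isingIdx G Λ) (gksCoupling G Λ β 0 .free) (isingSupp Λ)
    (fun τ => spinAt (⟨b, hb⟩ : ↥Λ) τ * spinAt (⟨c, hc⟩ : ↥Λ) τ)
  set Sap := gksSum (isingIdx G Λ) (gksCoupling G Λ β 0 .free) (isingSupp Λ)
    (fun τ => spinAt (⟨a, ha⟩ : ↥Λ) τ * spinAt (⟨p, hp⟩ : ↥Λ) τ)
  set Sbp := gksSum (isingIdx G Λ) (gksCoupling G Λ β 0 .free) (isingSupp Λ)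
    (fun τ => spinAt (⟨b, hb⟩ : ↥Λ) τ * spinAt (⟨p, hp⟩ : ↥Λ) τ)
  set Scp := gksSum (isingIdx G Λ) (gksCoupling G Λ β 0 .free) (isingSupp Λ)
    (fun τ => spinAt (⟨c, hc⟩ : ↥Λ) τ * spinAt (⟨p, hp⟩ : ↥Λ) τ)
  rw [← sub_nonpos]
  have hrew : Q / Z - (Sap / Z * (Sbc / Z) + Sbp / Z * (Sac / Z) + Scp / Z * (Sab / Z) -
      2 * (Sap / Z * (Sbp / Z) * (Scp / Z))) =
      (Z ^ 2 * Q - Z * (Sab * Scp + Sac * Sbp + Sbc * Sap) + 2 * (Sap * Sbp * Scp)) / Z ^ 3 := by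
    field_simp
    ring
  rw [hrew]
  exact div_nonpos_of_nonpos_of_nonneg h (by positivity)

end Literature.Probability.LatticeModels.GHSPivot

/-! ## Part B — the crux-side statements -/


namespace Summit.CriticalPhenomena.Ising3DConformalLimit.Cruxes.Interlacing.GHSPivot

open Filter MeasureTheory
open scoped Topology
open Literature.Probability.LatticeModels Literature.Probability.Percolation

/-- The axis point `k·e₁ ∈ ℤ³` in the spelling of the route decl. -/
abbrev ax (k : ℕ) : Site 3 := (k : ℤ) • (Pi.single 0 1 : Site 3)

/-- **First lemma (L1, provable now from the tree's `gksExpect_ghs`): the GHS pivot inequality in a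
free box.**  For the nearest-neighbour Ising model on a finite `Λ ⊂ ℤ³`, free boundary condition,
`β ≥ 0`, `h = 0`, and sites `p a b c ∈ Λ`:
`⟨σ_pσ_aσ_bσ_c⟩ ≤ G_pa G_bc + G_pb G_ac + G_pc G_ab - 2 G_pa G_pb G_pc`
(GHS in the system conditioned on `σ_p = +1`, whose extra couplings are the nonnegative fields
`β·1[i ~ p]`; Griffiths–Hurst–Sherman 1970, Lebowitz 1974 eq. (1.8)). -/
def GHSPivotFreeBox : Prop :=
  ∀ (Λ : Finset (Site 3)) (β : ℝ), 0 ≤ β → ∀ p a b c : Site 3, p ∈ Λ → a ∈ Λ → b ∈ Λ → c ∈ Λ →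
    isingExpect (zdGraph 3) Λ β 0 .free (spinMonomial ![p, a, b, c]) ≤
      isingTwoPoint (zdGraph 3) Λ β 0 .free p a * isingTwoPoint (zdGraph 3) Λ β 0 .free b c +
        isingTwoPoint (zdGraph 3) Λ β 0 .free p b * isingTwoPoint (zdGraph 3) Λ β 0 .free a c +
        isingTwoPoint (zdGraph 3) Λ β 0 .free p c * isingTwoPoint (zdGraph 3) Λ β 0 .free a b -
      2 * (isingTwoPoint (zdGraph 3) Λ β 0 .free p a * isingTwoPoint (zdGraph 3) Λ β 0 .free p b *
        isingTwoPoint (zdGraph 3) Λ β 0 .free p c)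

/-- **L2: the GHS pivot inequality for the critical state on `ℤ³`** (`criticalCorr 3`):
`S₄(p,a,b,c) ≤ G_pa G_bc + G_pb G_ac + G_pc G_ab - 2 G_pa G_pb G_pc`, i.e.
`-U₄(p,a,b,c) ≥ 2 G_pa G_pb G_pc` for every choice of the pivot `p` among the four points. -/
def GHSPivotCritical : Prop :=
  ∀ p a b c : Site 3,
    criticalCorr 3 4 ![p, a, b, c] ≤
      criticalCorr 3 2 ![p, a] * criticalCorr 3 2 ![b, c] + criticalCorr 3 2 ![p, b] * criticalCorr 3 2 ![a, c] +
        criticalCorr 3 2 ![p, c] * criticalCorr 3 2 ![a, b] -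
      2 * (criticalCorr 3 2 ![p, a] * criticalCorr 3 2 ![p, b] * criticalCorr 3 2 ![p, c])

/-- L1 ⇒ L2: the free boxes `Λ_L` at `β_c` converge to the critical state (`criticalCorr_wellDefined_holds`,
free = plus at `β_c(3)`), and the inequality is closed. -/
theorem ghsPivotCritical_of_freeBox (h : GHSPivotFreeBox) : GHSPivotCritical := by
  intro p a b c
  have hmem : (BoundaryCondition.free : BoundaryCondition (Site 3)) ∈
      ({.free, .plus, .minus} : Set (BoundaryCondition (Site 3))) := by simp
  have h4 : Tendsto (fun L : ℕ => isingExpect (zdGraph 3) (box 3 L) (criticalBeta 3) 0 .free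
      (spinMonomial ![p, a, b, c])) atTop (𝓝 (criticalCorr 3 4 ![p, a, b, c])) :=
    criticalCorr_wellDefined_holds (d := 3) le_rfl 4 _ .free hmem
  have hT : ∀ u v : Site 3, Tendsto (fun L : ℕ => isingTwoPoint (zdGraph 3) (box 3 L)
      (criticalBeta 3) 0 .free u v) atTop (𝓝 (criticalCorr 3 2 ![u, v])) := by
    intro u v
    have h2 := criticalCorr_wellDefined_holds (d := 3) le_rfl 2 ![u, v] .free hmem
    refine Tendsto.congr (fun L => ?_) h2
    simp only [isingTwoPoint, spinMonomial_two]
  -- the four points lie in `box 3 L` eventually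
  have hin : ∀ᶠ L : ℕ in atTop, ∀ i, (![p, a, b, c] : Fin 4 → Site 3) i ∈ box 3 L := by
    classical
    obtain ⟨L₀, hL₀⟩ := exists_forall_subset_box 3 (Finset.univ.image (![p, a, b, c] : Fin 4 → Site 3))
    filter_upwards [eventually_ge_atTop L₀] with L hL i
    exact hL₀ L hL (Finset.mem_image_of_mem _ (Finset.mem_univ i))
  have hev : ∀ᶠ L : ℕ in atTop,
      isingExpect (zdGraph 3) (box 3 L) (criticalBeta 3) 0 .free (spinMonomial ![p, a, b, c]) ≤
        isingTwoPoint (zdGraph 3) (box 3 L) (criticalBeta 3) 0 .free p a *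
            isingTwoPoint (zdGraph 3) (box 3 L) (criticalBeta 3) 0 .free b c +
          isingTwoPoint (zdGraph 3) (box 3 L) (criticalBeta 3) 0 .free p b *
            isingTwoPoint (zdGraph 3) (box 3 L) (criticalBeta 3) 0 .free a c +
          isingTwoPoint (zdGraph 3) (box 3 L) (criticalBeta 3) 0 .free p c *
            isingTwoPoint (zdGraph 3) (box 3 L) (criticalBeta 3) 0 .free a b -
        2 * (isingTwoPoint (zdGraph 3) (box 3 L) (criticalBeta 3) 0 .free p a *
            isingTwoPoint (zdGraph 3) (box 3 L) (criticalBeta 3) 0 .free p b *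
          isingTwoPoint (zdGraph 3) (box 3 L) (criticalBeta 3) 0 .free p c) := by
    filter_upwards [hin] with L hL
    exact h (box 3 L) (criticalBeta 3) (criticalBeta_nonneg 3) p a b c
      (by simpa using hL 0) (by simpa using hL 1) (by simpa using hL 2) (by simpa using hL 3)
  exact le_of_tendsto_of_tendsto h4
    (((((hT p a).mul (hT b c)).add ((hT p b).mul (hT a c))).add ((hT p c).mul (hT a b))).sub
      ((((hT p a).mul (hT p b)).mul (hT p c)).const_mul 2)) hev

/-- Permuting the first two arguments of a four-spin monomial does not change the correlation. -/
theorem corr4_swap01 (x q r w : Site 3) :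
    criticalCorr 3 4 ![x, q, r, w] = criticalCorr 3 4 ![q, x, r, w] := by
  simp only [criticalCorr]
  congr 1
  funext s
  simp only [spinMonomial, Fin.prod_univ_four, Fin.isValue, Matrix.cons_val_zero, Matrix.cons_val_one,
    Matrix.cons_val]
  ring

/-- Symmetry of the two-point function in its arguments. -/
theorem corr2_symm (x q : Site 3) : criticalCorr 3 2 ![x, q] = criticalCorr 3 2 ![q, x] := by
  simp only [criticalCorr]
  congr 1
  funext s
  simp only [spinMonomial, Fin.prod_univ_two, Fin.isValue, Matrix.cons_val_zero, Matrix.cons_val_one]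
  ring

/-- **L3 (provable now given L2): the GHS regime of the crux, pivot `x₂ = a·e₁`.**  Write
`P₁ = G(0,a)G(a+b,a+b+c)`, `P₂ = G(0,a+b)G(a,a+b+c)`, `P₃ = G(0,a+b+c)G(a,a+b)` and
`π₂ = G(0,a)·G(a,a+b)·G(a,a+b+c)` (the pivot-`x₂` tree term).  If the TWO-POINT data satisfy
`(P₁ + P₂ + P₃)·P₂ - P₁·P₃ ≤ 2·π₂·P₂` (equivalently `R₂ := G₁₂G₂₃/G₁₃ ≥ ι* := 1 - (u-1)(t-1)/2`), then the
interlacing inequality holds at `(a,b,c)`:  the GHS pivot bound `S₄ ≤ P₁+P₂+P₃ - 2π₂` closes it. -/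
theorem interlacing_of_ghsRegime_pivot2 (hG : GHSPivotCritical) (a b c : ℕ)
    (hP2 : 0 ≤ criticalCorr 3 2 ![ax 0, ax (a + b)] * criticalCorr 3 2 ![ax a, ax (a + b + c)])
    (hreg : (criticalCorr 3 2 ![ax 0, ax a] * criticalCorr 3 2 ![ax (a + b), ax (a + b + c)] +
          criticalCorr 3 2 ![ax 0, ax (a + b)] * criticalCorr 3 2 ![ax a, ax (a + b + c)] +
          criticalCorr 3 2 ![ax 0, ax (a + b + c)] * criticalCorr 3 2 ![ax a, ax (a + b)]) *
        (criticalCorr 3 2 ![ax 0, ax (a + b)] * criticalCorr 3 2 ![ax a, ax (a + b + c)]) -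
      criticalCorr 3 2 ![ax 0, ax a] * criticalCorr 3 2 ![ax (a + b), ax (a + b + c)] *
        (criticalCorr 3 2 ![ax 0, ax (a + b + c)] * criticalCorr 3 2 ![ax a, ax (a + b)]) ≤
      2 * (criticalCorr 3 2 ![ax 0, ax a] * criticalCorr 3 2 ![ax a, ax (a + b)] *
          criticalCorr 3 2 ![ax a, ax (a + b + c)]) *
        (criticalCorr 3 2 ![ax 0, ax (a + b)] * criticalCorr 3 2 ![ax a, ax (a + b + c)])) :
    criticalCorr 3 4 ![ax 0, ax a, ax (a + b), ax (a + b + c)] *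
        (criticalCorr 3 2 ![ax 0, ax (a + b)] * criticalCorr 3 2 ![ax a, ax (a + b + c)]) ≤
      criticalCorr 3 2 ![ax 0, ax a] * criticalCorr 3 2 ![ax (a + b), ax (a + b + c)] *
        (criticalCorr 3 2 ![ax 0, ax (a + b + c)] * criticalCorr 3 2 ![ax a, ax (a + b)]) := by
  -- GHS pivot at `p = x₂ = ax a` for the triple `(x₁, x₃, x₄)`
  have h := hG (ax a) (ax 0) (ax (a + b)) (ax (a + b + c))
  rw [← corr4_swap01] at h
  rw [corr2_symm (ax a) (ax 0)] at h
  -- `S₄ ≤ P₁ + P₂ + P₃ - 2π₂`; multiply by `P₂ ≥ 0` and use the regime hypothesis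
  have hmul := mul_le_mul_of_nonneg_right h hP2
  nlinarith [hmul, hreg]

/-- The same regime lemma in the crux's own spelling (`let p := fun k => (k:ℤ) • Pi.single 0 1`):
under L2, the GHS regime at `(a,b,c)` gives the `(a,b,c)` instance of `Interlacing`. -/
theorem interlacing_instance_of_ghsRegime (hG : GHSPivotCritical) (a b c : ℕ)
    (hP2 : 0 ≤ criticalCorr 3 2 ![ax 0, ax (a + b)] * criticalCorr 3 2 ![ax a, ax (a + b + c)])
    (hreg : (criticalCorr 3 2 ![ax 0, ax a] * criticalCorr 3 2 ![ax (a + b), ax (a + b + c)] +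
          criticalCorr 3 2 ![ax 0, ax (a + b)] * criticalCorr 3 2 ![ax a, ax (a + b + c)] +
          criticalCorr 3 2 ![ax 0, ax (a + b + c)] * criticalCorr 3 2 ![ax a, ax (a + b)]) *
        (criticalCorr 3 2 ![ax 0, ax (a + b)] * criticalCorr 3 2 ![ax a, ax (a + b + c)]) -
      criticalCorr 3 2 ![ax 0, ax a] * criticalCorr 3 2 ![ax (a + b), ax (a + b + c)] *
        (criticalCorr 3 2 ![ax 0, ax (a + b + c)] * criticalCorr 3 2 ![ax a, ax (a + b)]) ≤
      2 * (criticalCorr 3 2 ![ax 0, ax a] * criticalCorr 3 2 ![ax a, ax (a + b)] *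
          criticalCorr 3 2 ![ax a, ax (a + b + c)]) *
        (criticalCorr 3 2 ![ax 0, ax (a + b)] * criticalCorr 3 2 ![ax a, ax (a + b + c)])) :
    let p : ℕ → Site 3 := fun k => (k : ℤ) • (Pi.single 0 1 : Site 3)
    criticalCorr 3 4 ![p 0, p a, p (a + b), p (a + b + c)] *
        (criticalCorr 3 2 ![p 0, p (a + b)] * criticalCorr 3 2 ![p a, p (a + b + c)]) ≤
      criticalCorr 3 2 ![p 0, p a] * criticalCorr 3 2 ![p (a + b), p (a + b + c)] *
        (criticalCorr 3 2 ![p 0, p (a + b + c)] * criticalCorr 3 2 ![p a, p (a + b)]) :=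
  interlacing_of_ghsRegime_pivot2 hG a b c hP2 hreg


/-- **L1 holds** (Part A specialised to `zdGraph 3`). -/
theorem ghsPivotFreeBox_holds : GHSPivotFreeBox := fun Λ β hβ p a b c hp ha hb hc =>
  Literature.Probability.LatticeModels.GHSPivot.ghsPivot_free (zdGraph 3) hβ hp ha hb hc

/-- **L2 holds: the GHS pivot floor for the critical state on `ℤ³` is a theorem** —
`S₄(p,a,b,c) ≤ G_pa G_bc + G_pb G_ac + G_pc G_ab − 2 G_pa G_pb G_pc` for `criticalCorr 3`, all `p a b c`. -/
theorem ghsPivotCritical_holds : GHSPivotCritical := ghsPivotCritical_of_freeBox ghsPivotFreeBox_holds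

/-- **The GHS regime of the crux, unconditionally**: at any gap triple where the two-point data satisfy
`(P₁+P₂+P₃)·P₂ − P₁·P₃ ≤ 2·π₂·P₂` (i.e. `R₂ ≥ ι*`), the `(a,b,c)` instance of `Interlacing` holds. -/
theorem interlacing_instance_of_twoPointCriterion (a b c : ℕ)
    (hP2 : 0 ≤ criticalCorr 3 2 ![ax 0, ax (a + b)] * criticalCorr 3 2 ![ax a, ax (a + b + c)])
    (hreg : (criticalCorr 3 2 ![ax 0, ax a] * criticalCorr 3 2 ![ax (a + b), ax (a + b + c)] +
          criticalCorr 3 2 ![ax 0, ax (a + b)] * criticalCorr 3 2 ![ax a, ax (a + b + c)] +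
          criticalCorr 3 2 ![ax 0, ax (a + b + c)] * criticalCorr 3 2 ![ax a, ax (a + b)]) *
        (criticalCorr 3 2 ![ax 0, ax (a + b)] * criticalCorr 3 2 ![ax a, ax (a + b + c)]) -
      criticalCorr 3 2 ![ax 0, ax a] * criticalCorr 3 2 ![ax (a + b), ax (a + b + c)] *
        (criticalCorr 3 2 ![ax 0, ax (a + b + c)] * criticalCorr 3 2 ![ax a, ax (a + b)]) ≤
      2 * (criticalCorr 3 2 ![ax 0, ax a] * criticalCorr 3 2 ![ax a, ax (a + b)] *
          criticalCorr 3 2 ![ax a, ax (a + b + c)]) *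
        (criticalCorr 3 2 ![ax 0, ax (a + b)] * criticalCorr 3 2 ![ax a, ax (a + b + c)])) :
    let p : ℕ → Site 3 := fun k => (k : ℤ) • (Pi.single 0 1 : Site 3)
    criticalCorr 3 4 ![p 0, p a, p (a + b), p (a + b + c)] *
        (criticalCorr 3 2 ![p 0, p (a + b)] * criticalCorr 3 2 ![p a, p (a + b + c)]) ≤
      criticalCorr 3 2 ![p 0, p a] * criticalCorr 3 2 ![p (a + b), p (a + b + c)] *
        (criticalCorr 3 2 ![p 0, p (a + b + c)] * criticalCorr 3 2 ![p a, p (a + b)]) :=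
  interlacing_of_ghsRegime_pivot2 ghsPivotCritical_holds a b c hP2 hreg

end Summit.CriticalPhenomena.Ising3DConformalLimit.Cruxes.Interlacing.GHSPivot

end
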